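import Summits.BirchSwinnertonDyer.BirchSwinnertonDyer.Theorems.ThetaPartnerAtTwoSignedControlAtTwoRelaxedKummerCountAllLevels
import Summits.BirchSwinnertonDyer.BirchSwinnertonDyer.Theorems.QuadraticBranchSignedControlEtaLayerClassical
import Literature.NumberTheory.EllipticCurves.SelmerTorsionRestriction
import HarnessLib

/-!
# The level-`p^k` transport `Φ^M : H¹(Γ_L, E_L[p^k]) ≃ H¹(U, E[p^k])` over a Galois layer `L/K`, and the place-wise
# VANISHING dictionary «`loc_w z = 0` at every `w ∣ u`» ⟺ «`conj_σ (Φ^M z)` locally trivial at `u` for every `σ`»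
# (crux ♭T≤ stmt-BirchSwinnertonDyer-23042, line `sigmacongruence`, stub R1 `stub_relaxedImageCount`, brick (b′) of the relaxed count road)

Route `UniversalToricDescent`, lead prover `bsd-wall-utd-p1` g18. THEOREMS ONLY (no definition, no named fact, no `sorry`);
`--supports stmt-BirchSwinnertonDyer-23042`. BSD is not proved by any of this.

Setting: `K ⊆ L` number fields, `L/K` Galois, `U ≤ galRange L` normal in `Γ_K` with `res⁻¹(U)` all of `Γ_L` (route: `L = K_n`, `U = Γ_n`),
`E = W/K` elliptic, `n : ℤ` (route: `n = 3^k`). The relaxed count road needs, besides the `E`-points («Kummer ⟺ classical») dictionary of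
`…RelaxedLayerTransport`, the dictionary for the STRICT local condition (`loc_w = 0`), at the coefficient level `M = E[n]` where strictness
of the Poitou–Tate dual classes lives. This file packages the transport at level `M` as ONE map of a compatible pair,
`Φ^M = (toGal : U → Γ_L, (E[n] ≃ E_L[n])⁻¹)_*`, and proves:

* §1 generic bookkeeping: restriction to `U ⊓ τ⁻¹Dτ` kills `c` iff restriction to `U ⊓ D` kills `conj_τ c` (both are maps of compatible
  pairs with the same range, `LocBridge.resH1Hom_eq_zero_iff_of_range_eq`); a `Γ`-equivariant change of coefficients commutes with `resOfLe`
  and `conjH1`;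
* §2 ranges: `range (res_{ι₀∘τ}) = τ⁻¹ · range (res_{ι₀}) · τ`; for a `K ⊆ L` local package `(ι, ι₂, ι')` of cell `bsd-potss`,
  `g ∈ range (res_{ι'}) ⟺ resGal L g ∈ range (res_ι)` (`θ = ι₂(·)ι₂⁻¹` and its inverse); `D_u = range (res_{closureEmb K_u})`;
* §3 **`exists_transportTorsion`** — ∃ `Φ^M : H¹(Γ_L, E_L[n]) →+ H¹(U, E[n])`, BIJECTIVE, with, at every finite place `u` of `K` and every `z`:
  «`loc_w z = 0` for every place `w ∣ u` of `L`» ⟺ «`conj_σ (Φ^M z) ∈ awayKer U E[n] u` for every `σ ∈ Γ_K`» (file 2,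
  `…RelaxedLayerTransportTorsionPrimary`, puts `Φ^M` for `n = p^k` next to `Φ = (E[p^k] ↪ E[p^∞])_* ∘ Φ^M` and its Kummer dictionary).

References: [GreenbergLNM1716] §2 (pp. 62–63: the local conditions at the primes of `M` above a prime of `F`; "`G_{M_η}` … is just the
decomposition subgroup for some prime of `F̄` lying over `η`"); [SerreGaloisCohomology1997] I.§2.4 (compatible pairs), I.§2.5
(restriction, conjugation), II.§1.1 (embeddings of separable closures); [NeukirchANT1999] II.§8 (extensions of valuations, `L_w = L·K_u`).
-/

set_option linter.dupNamespace false
set_option autoImplicit false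

noncomputable section
open scoped Classical
open CategoryTheory Field NumberField IsDedekindDomain Function
open Literature.NumberTheory.EllipticCurves Literature.NumberTheory.EllipticCurves.GreenbergSelmer
open Literature.NumberTheory.GaloisRepresentations
open Literature.NumberTheory.GaloisCohomology
open scoped ContRepresentation
open scoped NumberField.LiesOver

namespace Summit.BirchSwinnertonDyer.BirchSwinnertonDyer.Theorems.UniversalToricDescentRelaxedLayerTransportTorsion

open Summit.BirchSwinnertonDyer.Rank1Residual.X11b.KummerPT Summit.BirchSwinnertonDyer.Rank1Residual.X11b.LocBridge
  Summit.BirchSwinnertonDyer.Rank1Residual.X11b.Levels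
  Summit.BirchSwinnertonDyer.BirchSwinnertonDyer.Theorems.SignedEC.RelaxedKummerCount
  Summit.BirchSwinnertonDyer.Rank1Residual.Additive Summit.BirchSwinnertonDyer.Rank1Residual.Additive.LocalTransport
  Summit.BirchSwinnertonDyer.Rank1Residual.Additive.BaseChange
  Summit.BirchSwinnertonDyer.BirchSwinnertonDyer.Theorems.EtaLayer

/-! ## §1 Generic bookkeeping: conjugate subgroups, change of coefficients -/

section Generic

variable {G : Type} [Group G] [TopologicalSpace G] [IsTopologicalGroup G]
  {M : Type} [AddCommGroup M] [DistribMulAction G M] [TopologicalSpace M] [DiscreteTopology M]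
  {N : Type} [AddCommGroup N] [DistribMulAction G N] [TopologicalSpace N] [DiscreteTopology N]

/-- **Restriction to `U ⊓ D'` with `D' = τ⁻¹ D τ` kills `c ∈ H¹(U, M)` iff restriction to `U ⊓ D` kills `conj_τ c`**: both are the
maps of compatible pairs into `U` with bijective coefficient maps (`id`, `τ • ·`) and the same range `U ⊓ τ⁻¹Dτ`
(`(conj_τ φ)(h) = τ • φ(τ⁻¹ h τ)`). [cite: SerreGaloisCohomology1997, I.§2.5] -/
theorem resOfLe_inf_eq_zero_iff_conjH1 (U : Subgroup G) [U.Normal] (D D' : Subgroup G) (τ : G)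
    (hDD' : ∀ g : G, g ∈ D' ↔ τ * g * τ⁻¹ ∈ D) (c : subgroupH1 U M) :
    resOfLe M (inf_le_left : U ⊓ D' ≤ U) c = 0 ↔
      resOfLe M (inf_le_left : U ⊓ D ≤ U) (conjH1 U M τ c) = 0 := by
  rw [conjH1, resOfLe, resOfLe, resH1Hom_resH1Hom]
  refine resH1Hom_eq_zero_iff_of_range_eq _ _ _ ⟨fun _ _ h ↦ h, fun b ↦ ⟨b, rfl⟩⟩ _ _ _
    (MulAction.bijective τ) ?_ c
  ext x
  constructor
  · rintro ⟨y, rfl⟩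
    have hy : (y : G) ∈ D' := (Subgroup.mem_inf.mp y.2).2
    have hyU : (y : G) ∈ U := (Subgroup.mem_inf.mp y.2).1
    have hτy : τ * y * τ⁻¹ ∈ U ⊓ D := Subgroup.mem_inf.mpr ⟨Subgroup.Normal.conj_mem inferInstance _ hyU τ, (hDD' y).mp hy⟩
    refine ⟨⟨τ * y * τ⁻¹, hτy⟩, Subtype.ext ?_⟩
    simp only [ContinuousMonoidHom.comp_toFun, subgroupConj_apply_coe, subgroupInclusion_apply_coe]
    group
  · rintro ⟨y, rfl⟩
    have hyD : (y : G) ∈ D := (Subgroup.mem_inf.mp y.2).2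
    have hyU : (y : G) ∈ U := (Subgroup.mem_inf.mp y.2).1
    have hmem : τ⁻¹ * y * τ ∈ U ⊓ D' := by
      refine Subgroup.mem_inf.mpr ⟨?_, (hDD' _).mpr ?_⟩
      · simpa only [inv_inv] using Subgroup.Normal.conj_mem inferInstance _ hyU τ⁻¹
      · have e : τ * (τ⁻¹ * (y : G) * τ) * τ⁻¹ = y := by group
        rw [e]
        exact hyD
    exact ⟨⟨τ⁻¹ * y * τ, hmem⟩, Subtype.ext (by
      simp only [ContinuousMonoidHom.comp_toFun, subgroupConj_apply_coe, subgroupInclusion_apply_coe])⟩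

/-- A `G`-equivariant change of coefficients `ψ_*` commutes with restriction `resOfLe` (both composites are the map of the pair
`(H ↪ H', ψ)`). [cite: SerreGaloisCohomology1997, I.§2.4] -/
theorem resOfLe_resH1Hom_id (ψ : M →+ N) (hψ : ∀ (g : G) (m : M), ψ (g • m) = g • ψ m) {H H' : Subgroup G}
    (h : H ≤ H') (c : subgroupH1 H' M) :
    resOfLe N h (resH1Hom (ContinuousMonoidHom.id H') ψ (fun x m ↦ hψ x m) c) =
      resH1Hom (ContinuousMonoidHom.id H) ψ (fun x m ↦ hψ x m) (resOfLe M h c) := by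
  rw [resOfLe, resOfLe, resH1Hom_resH1Hom, resH1Hom_resH1Hom]
  exact DFunLike.congr_fun (resH1Hom_congr (by ext; rfl) (by ext; rfl) _ _) c

/-- A `G`-equivariant change of coefficients `ψ_*` commutes with conjugation `conjH1` (both composites are the map of the pair
`(h ↦ σ⁻¹hσ, σ • ψ(·) = ψ(σ • ·))`). [cite: SerreGaloisCohomology1997, I.§2.5] -/
theorem conjH1_resH1Hom_id (ψ : M →+ N) (hψ : ∀ (g : G) (m : M), ψ (g • m) = g • ψ m) (H : Subgroup G) [H.Normal]
    (σ : G) (c : subgroupH1 H M) :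
    conjH1 H N σ (resH1Hom (ContinuousMonoidHom.id H) ψ (fun x m ↦ hψ x m) c) =
      resH1Hom (ContinuousMonoidHom.id H) ψ (fun x m ↦ hψ x m) (conjH1 H M σ c) := by
  rw [conjH1, conjH1, resH1Hom_resH1Hom, resH1Hom_resH1Hom]
  exact DFunLike.congr_fun (resH1Hom_congr (by ext; rfl) (by ext m; exact (hψ σ m).symm) _ _) c

end Generic

/-! ## §2 Ranges of the restriction maps attached to embeddings -/

section Ranges

variable {K : Type} [Field K] {E : Type} [Field E] [Algebra K E]

/-- **`range (res_{ι₀ ∘ τ}) = τ⁻¹ · range (res_{ι₀}) · τ`** (`res_{ι₀∘τ} g = τ⁻¹ (res_{ι₀} g) τ`, `resGalOfEmb_comp_apply`).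
[cite: SerreGaloisCohomology1997, II.§1.1] -/
theorem mem_range_resGalOfEmb_comp_iff (ι₀ : AlgebraicClosure K →ₐ[K] AlgebraicClosure E)
    (τ : AlgebraicClosure K ≃ₐ[K] AlgebraicClosure K) (g : absoluteGaloisGroup K) :
    g ∈ (resGalOfEmb (ι₀.comp (τ : AlgebraicClosure K →ₐ[K] AlgebraicClosure K))).toMonoidHom.range ↔
      (show absoluteGaloisGroup K from τ) * g * (show absoluteGaloisGroup K from τ)⁻¹ ∈
        (resGalOfEmb ι₀).toMonoidHom.range := by
  constructor
  · rintro ⟨h, rfl⟩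
    refine ⟨h, ?_⟩
    change resGalOfEmb ι₀ h = (show absoluteGaloisGroup K from τ) *
      resGalOfEmb (ι₀.comp (τ : AlgebraicClosure K →ₐ[K] AlgebraicClosure K)) h * (show absoluteGaloisGroup K from τ)⁻¹
    rw [resGalOfEmb_comp_apply]
    group
  · rintro ⟨h, hh⟩
    refine ⟨h, ?_⟩
    change resGalOfEmb (ι₀.comp (τ : AlgebraicClosure K →ₐ[K] AlgebraicClosure K)) h = g
    have hh' : resGalOfEmb ι₀ h = (show absoluteGaloisGroup K from τ) * g * (show absoluteGaloisGroup K from τ)⁻¹ := hh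
    rw [resGalOfEmb_comp_apply, hh']
    group

/-- `D_u = range (res_{closureEmb K_u})` (`GreenbergSelmer.decomp` is the range of `absGaloisRestrict K K_u = resGalOfEmb (closureEmb K_u)`).
[cite: Greenberg1989, §1 p. 98] -/
theorem decomp_eq_range [NumberField K] (u : HeightOneSpectrum (𝓞 K)) :
    decomp (K := K) u = (resGalOfEmb (closureEmb (K := K) (u.adicCompletion K))).toMonoidHom.range :=
  rfl

variable (L : Type) [Field L] [Algebra K L] [Algebra.IsAlgebraic K L] {E' : Type} [Field E'] [Algebra L E']
  (ι : AlgebraicClosure K →ₐ[K] AlgebraicClosure E) (ι₂ : AlgebraicClosure E ≃+* AlgebraicClosure E')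
  (ι' : AlgebraicClosure L →ₐ[L] AlgebraicClosure E')
  (hcompat : ∀ z : AlgebraicClosure K, ι' (closureEmb (K := K) L z) = ι₂ (ι z)) (f : E →+* E')
  (hf : ∀ y : E, ι₂ (algebraMap E (AlgebraicClosure E) y) = algebraMap E' (AlgebraicClosure E') (f y))
  (hfix : ∀ h : absoluteGaloisGroup E, resGalOfEmb ι h ∈ galRange (K := K) L → ∀ y : E',
    (show AlgebraicClosure E ≃ₐ[E] AlgebraicClosure E from h) (ι₂.symm (algebraMap E' (AlgebraicClosure E') y)) =
      ι₂.symm (algebraMap E' (AlgebraicClosure E') y))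

include hcompat hf hfix in
/-- **For a local package `(ι, ι₂, ι')`: `g ∈ range (res_{ι'}) ⟺ resGal L g ∈ range (res_ι)`** — `→` by the inverse transport
`ι₂⁻¹(·)ι₂` (`EtaLayer.resGalOfEmb_transportAut_symm`), `←` by the transport `ι₂(·)ι₂⁻¹` (`resGal_resGalOfEmb_transportAut`) and
injectivity of `resGal L`. [cite: SerreGaloisCohomology1997, II.§1.1] [cite: NeukirchANT1999, Ch. II §8] -/
theorem mem_range_resGalOfEmb_iff_resGal_mem (g : absoluteGaloisGroup L) :
    g ∈ (resGalOfEmb (K := L) ι').toMonoidHom.range ↔ resGal (K := K) L g ∈ (resGalOfEmb ι).toMonoidHom.range := by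
  constructor
  · rintro ⟨t, rfl⟩
    refine ⟨transportAut ι₂.symm t (fix_symm ι₂ f hf t), ?_⟩
    change resGalOfEmb ι _ = resGal (K := K) L (resGalOfEmb (K := L) ι' t)
    exact resGalOfEmb_transportAut_symm L ι ι₂ ι' hcompat t _
  · rintro ⟨h, hh⟩
    have hh' : resGalOfEmb ι h = resGal (K := K) L g := hh
    have hmem : resGalOfEmb ι h ∈ galRange (K := K) L := ⟨g, hh'.symm⟩
    refine ⟨transportAut ι₂ h (hfix h hmem), ?_⟩
    apply resGal_injective (K := K) L
    change resGal (K := K) L (resGalOfEmb (K := L) ι' (transportAut ι₂ h (hfix h hmem))) = resGal (K := K) L g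
    rw [resGal_resGalOfEmb_transportAut L ι ι₂ ι' hcompat h (hfix h hmem), hh']

end Ranges

/-! ## §3 The level-`n` transport and the vanishing dictionary -/

section Transport

variable {K : Type} [Field K] [NumberField K] (W : WeierstrassCurve K) [W.IsElliptic] (n : ℤ)
  (L : Type) [Field L] [NumberField L] [Algebra K L]
  {U : Subgroup (absoluteGaloisGroup K)} [U.Normal] (hU : U ≤ galRange (K := K) L)
  (hH : ∀ τ : absoluteGaloisGroup L, τ ∈ comapResGal L U)

omit [NumberField K] [W.IsElliptic] [NumberField L] [U.Normal] in
/-- Compatibility of the pair `(toGal : U → Γ_L, (E[n] ≃ E_L[n])⁻¹)`. [cite: SerreGaloisCohomology1997, I.§2.4] -/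
theorem torsionBaseChangeEquiv_symm_toGal_smul [Algebra.IsAlgebraic K L] [PerfectField L] (τ : U) (Q : (W.baseChange L).geomTorsion n) :
    (torsionBaseChangeEquiv L W n).symm (toGal L hU τ • Q) = τ • (torsionBaseChangeEquiv L W n).symm Q := by
  rw [toGal_apply, Subgroup.smul_def]
  have h := torsionBaseChangeEquiv_symm_smul L W n ⟨τ, hU τ.2⟩ Q
  rw [Subgroup.smul_def] at h
  exact h

omit [NumberField K] [W.IsElliptic] [NumberField L] [U.Normal] in
include hH in
/-- Compatibility of the pair `(Γ_L → U, σ ↦ resGal σ; E[n] ≃ E_L[n])`. [cite: SerreGaloisCohomology1997, I.§2.4] -/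
theorem torsionBaseChangeEquiv_resGal_smul [Algebra.IsAlgebraic K L] (σ : absoluteGaloisGroup L) (P : W.geomTorsion n) :
    torsionBaseChangeEquiv L W n ((⟨resGal (K := K) L σ, hH σ⟩ : U) • P) = σ • torsionBaseChangeEquiv L W n P := by
  rw [Subgroup.smul_def]
  have h := torsionBaseChangeEquiv_smul L W n σ P
  rw [Subgroup.smul_def, coe_resGalToRange] at h
  exact h

omit [W.IsElliptic] [U.Normal] in
include hH in
/-- **The transport along a local package is range-preserving on `H¹`**: for a package `(ι, ι₂, ι')` and `z ∈ H¹(Γ_L, E_L[n])`,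
restriction of `z` to `⊤ ⊓ range (res_{ι'})` vanishes iff restriction of `(toGal, (E[n] ≃ E_L[n])⁻¹)_* z ∈ H¹(U, E[n])` to
`U ⊓ range (res_ι)` vanishes (the two compatible pairs `Γ_L ⊇ · → Γ_L` have the same range, §2).
[cite: SerreGaloisCohomology1997, I.§2.4, II.§1.1] -/
theorem resOfLe_transport_eq_zero_iff [PerfectField L] {E : Type} [Field E] [Algebra K E] {E' : Type} [Field E'] [Algebra L E']
    (ι : AlgebraicClosure K →ₐ[K] AlgebraicClosure E) (ι₂ : AlgebraicClosure E ≃+* AlgebraicClosure E')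
    (ι' : AlgebraicClosure L →ₐ[L] AlgebraicClosure E')
    (hcompat : ∀ z : AlgebraicClosure K, ι' (closureEmb (K := K) L z) = ι₂ (ι z)) (f : E →+* E')
    (hf : ∀ y : E, ι₂ (algebraMap E (AlgebraicClosure E) y) = algebraMap E' (AlgebraicClosure E') (f y))
    (hfix : ∀ h : absoluteGaloisGroup E, resGalOfEmb ι h ∈ galRange (K := K) L → ∀ y : E',
      (show AlgebraicClosure E ≃ₐ[E] AlgebraicClosure E from h) (ι₂.symm (algebraMap E' (AlgebraicClosure E') y)) =
        ι₂.symm (algebraMap E' (AlgebraicClosure E') y))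
    (z : discreteH1 (absoluteGaloisGroup L) ((W.baseChange L).geomTorsion n)) :
    resOfLe ((W.baseChange L).geomTorsion n)
        (inf_le_left : (⊤ : Subgroup (absoluteGaloisGroup L)) ⊓ (resGalOfEmb (K := L) ι').toMonoidHom.range ≤ ⊤)
        (resH1Hom (Literature.NumberTheory.EllipticCurves.subgroupIncl (⊤ : Subgroup (absoluteGaloisGroup L)))
          (AddMonoidHom.id _) (fun _ _ ↦ rfl) z) = 0 ↔
      resOfLe (W.geomTorsion n) (inf_le_left : U ⊓ (resGalOfEmb ι).toMonoidHom.range ≤ U)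
        (resH1Hom (toGal L hU) (torsionBaseChangeEquiv L W n).symm.toAddMonoidHom
          (torsionBaseChangeEquiv_symm_toGal_smul W n L hU) z) = 0 := by
  rw [resOfLe, resOfLe, resH1Hom_resH1Hom, resH1Hom_resH1Hom]
  refine resH1Hom_eq_zero_iff_of_range_eq _ _ _ ⟨fun _ _ h ↦ h, fun b ↦ ⟨b, rfl⟩⟩ _ _ _
    (torsionBaseChangeEquiv L W n).symm.bijective ?_ z
  ext g
  constructor
  · rintro ⟨y, rfl⟩
    have hy : (y : absoluteGaloisGroup L) ∈ (resGalOfEmb (K := L) ι').toMonoidHom.range := (Subgroup.mem_inf.mp y.2).2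
    have h1 := (mem_range_resGalOfEmb_iff_resGal_mem L ι ι₂ ι' hcompat f hf hfix _).mp hy
    refine ⟨⟨resGal (K := K) L y, Subgroup.mem_inf.mpr ⟨hH y, h1⟩⟩, ?_⟩
    change toGal L hU ⟨resGal (K := K) L y, hH y⟩ = (y : absoluteGaloisGroup L)
    rw [toGal_apply]
    have e : (⟨resGal (K := K) L y, hU (hH y)⟩ : galRange (K := K) L) = resGalToRange (K := K) L y := Subtype.ext rfl
    rw [e, rangeToResGal_resGalToRange]
  · rintro ⟨x, rfl⟩
    have hx : (x : absoluteGaloisGroup K) ∈ (resGalOfEmb ι).toMonoidHom.range := (Subgroup.mem_inf.mp x.2).2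
    have hval : ((toGal L hU).comp (subgroupInclusion (inf_le_left : U ⊓ (resGalOfEmb ι).toMonoidHom.range ≤ U)) x :
        absoluteGaloisGroup L) = toGal L hU ⟨x, (Subgroup.mem_inf.mp x.2).1⟩ := rfl
    have hmem : toGal L hU ⟨x, (Subgroup.mem_inf.mp x.2).1⟩ ∈ (resGalOfEmb (K := L) ι').toMonoidHom.range := by
      rw [mem_range_resGalOfEmb_iff_resGal_mem L ι ι₂ ι' hcompat f hf hfix, resGal_toGal]
      exact hx
    exact ⟨⟨toGal L hU ⟨x, (Subgroup.mem_inf.mp x.2).1⟩, Subgroup.mem_inf.mpr ⟨Subgroup.mem_top _, hmem⟩⟩, hval.symm⟩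

omit [W.IsElliptic] in
include hH in
/-- **The level-`n` transport `Φ^M : H¹(Γ_L, E_L[n]) → H¹(U, E[n])`, bijective, with the place-wise vanishing dictionary**
«`loc_w z = 0` at every `w ∣ u`» ⟺ «`conj_σ (Φ^M z) ∈ awayKer U E[n] u` for every `σ ∈ Γ_K`» at every finite place `u` of `K`
(`L/K` Galois; `→`: package from the `K`-embedding `closureEmb K_u ∘ σ`, `←`: package from the `L`-embedding `closureEmb L_w`;
Greenberg: the decomposition subgroups of the primes of `F̄` over `η`). [cite: GreenbergLNM1716, §2 (pp. 62–63)]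
[cite: SerreGaloisCohomology1997, I.§2.4–2.5, II.§1.1] [cite: NeukirchANT1999, Ch. II §8] -/
theorem exists_transportTorsion [IsGalois K L] :
    ∃ ΦM : galoisCohomology ((W.baseChange L).torsionGaloisModule n) 1 →+ subgroupH1 U (W.geomTorsion n),
      Function.Bijective ΦM ∧
      (∀ [PerfectField L], ∀ z, ΦM z = resH1Hom (toGal L hU) (torsionBaseChangeEquiv L W n).symm.toAddMonoidHom
          (torsionBaseChangeEquiv_symm_toGal_smul W n L hU) z) ∧
      ∀ (u : HeightOneSpectrum (𝓞 K)) (z : galoisCohomology ((W.baseChange L).torsionGaloisModule n) 1),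
        (∀ w : HeightOneSpectrum (𝓞 L), w.asIdeal.LiesOver u.asIdeal →
          galoisCohomology.localization ((W.baseChange L).torsionGaloisModule n) (Sum.inr w) 1 z = 0) ↔
        ∀ σ : absoluteGaloisGroup K, conjH1 U (W.geomTorsion n) σ (ΦM z) ∈ awayKer U (W.geomTorsion n) u := by
  classical
  haveI : PerfectField K := PerfectField.ofCharZero
  haveI hPL : PerfectField L := PerfectField.ofCharZero
  -- the transport and its inverse
  let ΦM : galoisCohomology ((W.baseChange L).torsionGaloisModule n) 1 →+ subgroupH1 U (W.geomTorsion n) :=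
    resH1Hom (toGal L hU) (torsionBaseChangeEquiv L W n).symm.toAddMonoidHom (torsionBaseChangeEquiv_symm_toGal_smul W n L hU)
  let π : absoluteGaloisGroup L →ₜ* U :=
    { toFun := fun σ ↦ ⟨resGal (K := K) L σ, hH σ⟩
      map_one' := Subtype.ext (map_one _)
      map_mul' := fun _ _ ↦ Subtype.ext (map_mul _ _ _)
      continuous_toFun := (resGal (K := K) L).continuous_toFun.subtype_mk _ }
  let ΨM : subgroupH1 U (W.geomTorsion n) →+ galoisCohomology ((W.baseChange L).torsionGaloisModule n) 1 :=
    resH1Hom π (torsionBaseChangeEquiv L W n).toAddMonoidHom (torsionBaseChangeEquiv_resGal_smul W n L hH)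
  have hleft : ∀ z, ΨM (ΦM z) = z := fun z ↦ by
    change resH1Hom π _ _ (resH1Hom (toGal L hU) _ _ z) = z
    rw [resH1Hom_resH1Hom]
    have e : resH1Hom ((toGal L hU).comp π)
        ((torsionBaseChangeEquiv L W n).toAddMonoidHom.comp (torsionBaseChangeEquiv L W n).symm.toAddMonoidHom)
        (fun x m ↦ by
          simp only [AddMonoidHom.coe_comp, Function.comp_apply, AddEquiv.coe_toAddMonoidHom, ContinuousMonoidHom.comp_toFun,
            torsionBaseChangeEquiv_symm_toGal_smul]
          exact torsionBaseChangeEquiv_resGal_smul W n L hH x _) =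
        resH1Hom (ContinuousMonoidHom.id _) (AddMonoidHom.id _) (fun _ _ ↦ rfl) := by
      refine resH1Hom_congr (ContinuousMonoidHom.ext fun σ ↦ ?_)
        (AddMonoidHom.ext fun Q ↦ (torsionBaseChangeEquiv L W n).apply_symm_apply Q) _ _
      change toGal L hU ⟨resGal (K := K) L σ, hH σ⟩ = σ
      rw [toGal_apply]
      have e : (⟨resGal (K := K) L σ, hU (hH σ)⟩ : galRange (K := K) L) = resGalToRange (K := K) L σ := Subtype.ext rfl
      rw [e, rangeToResGal_resGalToRange]
    rw [e, resH1Hom_id]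
    rfl
  have hright : ∀ c, ΦM (ΨM c) = c := fun c ↦ by
    change resH1Hom (toGal L hU) _ _ (resH1Hom π _ _ c) = c
    rw [resH1Hom_resH1Hom]
    have e : resH1Hom (π.comp (toGal L hU))
        ((torsionBaseChangeEquiv L W n).symm.toAddMonoidHom.comp (torsionBaseChangeEquiv L W n).toAddMonoidHom)
        (fun x m ↦ by
          simp only [AddMonoidHom.coe_comp, Function.comp_apply, AddEquiv.coe_toAddMonoidHom, ContinuousMonoidHom.comp_toFun]
          change (torsionBaseChangeEquiv L W n).symm (torsionBaseChangeEquiv L W n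
              ((⟨resGal (K := K) L (toGal L hU x), hH _⟩ : U) • m)) = _
          rw [torsionBaseChangeEquiv_resGal_smul W n L hH, torsionBaseChangeEquiv_symm_toGal_smul]) =
        resH1Hom (ContinuousMonoidHom.id _) (AddMonoidHom.id _) (fun _ _ ↦ rfl) := by
      refine resH1Hom_congr (ContinuousMonoidHom.ext fun τ ↦ Subtype.ext ?_)
        (AddMonoidHom.ext fun P ↦ (torsionBaseChangeEquiv L W n).symm_apply_apply P) _ _
      change resGal (K := K) L (toGal L hU τ) = τ
      exact resGal_toGal L hU τ
    rw [e, resH1Hom_id]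
    rfl
  have hbij : Function.Bijective ΦM :=
    ⟨Function.LeftInverse.injective (g := ΨM) hleft, Function.RightInverse.surjective (g := ΨM) hright⟩
  refine ⟨ΦM, hbij, fun z ↦ ?_, fun u z ↦ ?_⟩
  · -- the formula (any two `PerfectField L` instances agree)
    exact DFunLike.congr_fun (resH1Hom_congr rfl rfl _ _) z
  -- `loc_w z = 0` ⟺ restriction to `⊤ ⊓ D_w` kills `ι₂M z`
  have hloc : ∀ w : HeightOneSpectrum (𝓞 L),
      galoisCohomology.localization ((W.baseChange L).torsionGaloisModule n) (Sum.inr w) 1 z = 0 ↔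
        resOfLe ((W.baseChange L).geomTorsion n)
          (inf_le_left : (⊤ : Subgroup (absoluteGaloisGroup L)) ⊓
            (resGalOfEmb (K := L) (closureEmb (K := L) (w.adicCompletion L))).toMonoidHom.range ≤ ⊤)
          (resH1Hom (Literature.NumberTheory.EllipticCurves.subgroupIncl (⊤ : Subgroup (absoluteGaloisGroup L)))
            (AddMonoidHom.id ((W.baseChange L).geomTorsion n)) (fun _ _ ↦ rfl) z) = 0 := by
    intro w
    rw [← decomp_eq_range]
    have h1 := localization_inr_eq_zero_iff (isOpen_stabilizer_geomTorsion' (W.baseChange L) n) w z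
    refine h1.trans ?_
    change resH1Hom (Literature.NumberTheory.EllipticCurves.subgroupIncl (decomp w)) (AddMonoidHom.id _) (fun _ _ ↦ rfl) z = 0 ↔
      resH1Hom _ _ _ (resH1Hom _ _ _ z) = 0
    rw [resH1Hom_resH1Hom]
    refine resH1Hom_eq_zero_iff_of_range_eq _ _ _ ⟨fun _ _ h ↦ h, fun b ↦ ⟨b, rfl⟩⟩ _ _ _
      ⟨fun _ _ h ↦ h, fun b ↦ ⟨b, rfl⟩⟩ ?_ z
    ext g
    constructor
    · rintro ⟨y, rfl⟩
      exact ⟨⟨y, Subgroup.mem_inf.mpr ⟨Subgroup.mem_top _, y.2⟩⟩, rfl⟩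
    · rintro ⟨y, rfl⟩
      exact ⟨⟨(y : absoluteGaloisGroup L), (Subgroup.mem_inf.mp y.2).2⟩, rfl⟩
  -- conjugation by `Γ_L` is trivial on `H¹(⊤, ·)`
  have hconjL : ∀ (τ : absoluteGaloisGroup L) (c : subgroupH1 (⊤ : Subgroup (absoluteGaloisGroup L)) ((W.baseChange L).geomTorsion n)),
      conjH1 ⊤ ((W.baseChange L).geomTorsion n) τ c = c := fun τ c ↦ by
    rw [Literature.NumberTheory.EllipticCurves.conjH1_of_mem_holds ⊤ ((W.baseChange L).geomTorsion n) (Subgroup.mem_top τ), AddMonoidHom.id_apply]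
  -- the subgroup-model class, vanishing on `⊤ ⊓ range(res_{ι'})` for ANY `L`-embedding `ι'` into `L̄_w`, iff `loc_w z = 0`
  have hany : ∀ (w : HeightOneSpectrum (𝓞 L)) (ι' : AlgebraicClosure L →ₐ[L] AlgebraicClosure (w.adicCompletion L)),
      resOfLe ((W.baseChange L).geomTorsion n)
          (inf_le_left : (⊤ : Subgroup (absoluteGaloisGroup L)) ⊓ (resGalOfEmb (K := L) ι').toMonoidHom.range ≤ ⊤)
          (resH1Hom (Literature.NumberTheory.EllipticCurves.subgroupIncl (⊤ : Subgroup (absoluteGaloisGroup L)))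
            (AddMonoidHom.id ((W.baseChange L).geomTorsion n)) (fun _ _ ↦ rfl) z) = 0 ↔
        galoisCohomology.localization ((W.baseChange L).torsionGaloisModule n) (Sum.inr w) 1 z = 0 := by
    intro w ι'
    obtain ⟨τ', rfl⟩ := exists_algHom_eq_comp (closureEmb (K := L) (w.adicCompletion L)) ι'
    rw [hloc w, resOfLe_inf_eq_zero_iff_conjH1 ⊤ _ _ (show absoluteGaloisGroup L from τ')
      (mem_range_resGalOfEmb_comp_iff (closureEmb (K := L) (w.adicCompletion L)) τ') _, hconjL]
  constructor
  · -- `loc_w z = 0` at every `w ∣ u` ⟹ `conj_σ (ΦM z)` locally trivial at `u`, for every `σ`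
    intro hz σ
    -- the package for the `K`-embedding `closureEmb K_u ∘ σ`
    let ι : AlgebraicClosure K →ₐ[K] AlgebraicClosure (u.adicCompletion K) :=
      (closureEmb (K := K) (u.adicCompletion K)).comp
        ((show AlgebraicClosure K ≃ₐ[K] AlgebraicClosure K from σ) : AlgebraicClosure K →ₐ[K] AlgebraicClosure K)
    obtain ⟨w, hw, ι₂, ι', hcompat, hf, hfixL⟩ := exists_package_adicCompletion L u (RingEquiv.refl _) (fun _ ↦ rfl) ι
    have h1 := (resOfLe_transport_eq_zero_iff W n L hU hH ι ι₂ ι' hcompat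
      ((adicCompletionMap (K := K) L u w).comp (RingEquiv.refl (u.adicCompletion K)).symm.toRingHom) hf hfixL z).mp
      ((hany w ι').mpr (hz w hw))
    rw [awayKer, AddMonoidHom.mem_ker]
    exact (resOfLe_inf_eq_zero_iff_conjH1 U (decomp u) _ σ
      (mem_range_resGalOfEmb_comp_iff (closureEmb (K := K) (u.adicCompletion K))
        (show AlgebraicClosure K ≃ₐ[K] AlgebraicClosure K from σ)) (ΦM z)).mp h1
  · -- locally trivial for every conjugate ⟹ `loc_w z = 0` at every `w ∣ u`
    intro hσ w hw
    haveI := hw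
    -- the package for the `L`-embedding `closureEmb L_w`
    obtain ⟨ι, ι₂, hcompat, hf, hfixL⟩ :=
      exists_package_adicCompletion_of_embedding L u (RingEquiv.refl _) (fun _ ↦ rfl) w
        (closureEmb (K := L) (w.adicCompletion L))
    rw [← hany w (closureEmb (K := L) (w.adicCompletion L)),
      resOfLe_transport_eq_zero_iff W n L hU hH ι ι₂ _ hcompat
        ((adicCompletionMap (K := K) L u w).comp (RingEquiv.refl (u.adicCompletion K)).symm.toRingHom) hf hfixL z]
    obtain ⟨τ, rfl⟩ := exists_algHom_eq_comp (closureEmb (K := K) (u.adicCompletion K)) ι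
    have h2 := hσ (show absoluteGaloisGroup K from τ)
    rw [awayKer, AddMonoidHom.mem_ker] at h2
    exact (resOfLe_inf_eq_zero_iff_conjH1 U (decomp u) _ (show absoluteGaloisGroup K from τ)
      (mem_range_resGalOfEmb_comp_iff (closureEmb (K := K) (u.adicCompletion K)) τ) (ΦM z)).mpr h2

end Transport

end Summit.BirchSwinnertonDyer.BirchSwinnertonDyer.Theorems.UniversalToricDescentRelaxedLayerTransportTorsion

end
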